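import Summits.CriticalPhenomena.SAWScalingLimit.Theorems.SAWDevelopingMapObservableToSLETypeLadderCarvedReductionSqueezeCellLimits
import Summits.CriticalPhenomena.SAWScalingLimit.Theorems.SAWDevelopingMapObservableToSLETypeLadderCarvedReductionSqueezeFatLimits
import HarnessLib

/-!
# Simultaneous limits: cells with their own roots, finitely many fat sets (piece (T-A lim-e) of stub
# T-A `stub_carvedReduction_squeezeGeometry`)

Crux `SAWDevelopingMap.ObservableToSLE` (stmt-CriticalPhenomena-10472), line `six-class-type-ladder`,
stub T-A `stub_carvedReduction_squeezeGeometry`.  Landing target: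
`Summits/CriticalPhenomena/SAWScalingLimit/Theorems/SAWDevelopingMapObservableToSLETypeLadderCarvedReductionSqueezeMultiLimits.lean`
(`--supports stmt-CriticalPhenomena-10472`).  Sequel of `…SqueezeCellLimits` (`cells_limits`) and
`…SqueezeFatLimits` (`fat_limits`).

The squeeze follows, along ONE subsequence, the level hexagons of BOTH removed families (`S` at the
root `a`, `T` at the root `b`) and four fat compact connected sets (the two spines, the two bodies
under the windows).  To keep the diagonal extraction short this file gives the multi-index forms:
* `cells_limits_roots` — `cells_limits` with a root per cell (the `S`-cells are `R`-local about
  `a`, the `T`-cells about `b`): convergence of pinned centres / radii along a subsequence,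
  persistence, containment, eventual carving of compacts, hexagon by hexagon;
* `fats_limits` — `fat_limits` for finitely many fat-set sequences at once (Blaschke selection in
  the finite product of hyperspaces, `TypeLadder.exists_subseq_tendsto_nonemptyCompacts_pi`): one
  subsequence along which every pinned fat set converges in the Hausdorff metric to a compact
  connected limit through its limit pinned root, inside its disc, with persistently removed core and
  the extra clauses carried along.
Registered carrier: `stub_carvedReduction_exists_min_pos`.
-/

noncomputable section

open scoped Topology
open Filter Set Metric TopologicalSpace
open Literature.Probability.LatticeModels (HexVertex hexGraph hexCenter triZeta triEmbed Site)
open Literature.Probability.RandomPlanarGeometry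
open Literature.Probability.Percolation (norm_triZeta)
open Literature.Probability.Percolation.QuadCrossing (mem_of_tendsto_of_hausdorffDist_tendsto
  isPreconnected_of_hausdorffDist_tendsto)

namespace Summit.CriticalPhenomena.SAWScalingLimit.Theorems.ObservableToSLE.TypeLadder

open Summit.CriticalPhenomena.SAWScalingLimit.Theorems.ObservableToSLER.BridgeGate
open Summit.CriticalPhenomena.SAWScalingLimit.Theorems.ObservableToSLE.FloorRatio (exists_vertex_dist_le)

/-- A positive lower bound for finitely many positive reals. -/
theorem exists_min_pos {ι : Type*} [Finite ι] (r : ι → ℝ) (hr : ∀ i, 0 < r i) :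
    ∃ m > (0 : ℝ), ∀ i, m ≤ r i := by
  classical
  rcases isEmpty_or_nonempty ι with hι | hι
  · exact ⟨1, one_pos, fun i => (IsEmpty.false i).elim⟩
  · haveI := Fintype.ofFinite ι
    refine ⟨Finset.univ.inf' Finset.univ_nonempty r, ?_, fun i => Finset.inf'_le _ (Finset.mem_univ i)⟩
    exact (Finset.lt_inf'_iff _).2 fun i _ => hr i

/-- **Registered sub-goal `stub_carvedReduction_exists_min_pos`** (crux item stmt-CriticalPhenomena-10472,
stub T-A `stub_carvedReduction_squeezeGeometry`, piece (T-A lim-e)). -/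
theorem stub_carvedReduction_exists_min_pos :
    ∀ (N : ℕ) (r : Fin N → ℝ), (∀ i, 0 < r i) → ∃ m > (0 : ℝ), ∀ i, m ≤ r i :=
  fun _ r hr => exists_min_pos r hr

/-! ### Cells with their own roots -/

/-- **LIMITS OF PRESCRIBED PINNED CELLS, a root per cell**: as `cells_limits`, the hexagon of the
cell `g j i` being `R`-local about `root j i`, with pinned roots `s_j c_{root j i} - τ j → ℓ₀ i`. -/
theorem cells_limits_roots {ι : Type*} [Fintype ι] {s : ℕ → ℝ} {τ : ℕ → ℂ} {g : ℕ → ι → HexVertex × ℕ}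
    {root : ℕ → ι → HexVertex} {R : ℝ} {ℓ₀ : ι → ℂ} (hspos : ∀ j, 0 < s j) (hs0 : Tendsto s atTop (𝓝 0))
    (hloc : ∀ j i, ∀ v ∈ hexBall (g j i).1 (g j i).2,
      dist ((s j : ℂ) * hexCenter v) ((s j : ℂ) * hexCenter (root j i)) ≤ R)
    (hrootlim : ∀ i, Tendsto (fun j => (s j : ℂ) * hexCenter (root j i) - τ j) atTop (𝓝 (ℓ₀ i))) :
    ∃ (ψ : ℕ → ℕ) (C : ι → ℂ) (ϱ : ι → ℝ),
      StrictMono ψ ∧ (∀ i, 0 ≤ ϱ i) ∧ (∀ i, dist (C i) (ℓ₀ i) ≤ R) ∧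
      (∀ i, Tendsto (fun j => (s (ψ j) : ℂ) * hexCenter (g (ψ j) i).1 - τ (ψ j)) atTop (𝓝 (C i))) ∧
      (∀ i, Tendsto (fun j => s (ψ j) * ((g (ψ j) i).2 + 1 / 2)) atTop (𝓝 (ϱ i))) ∧
      (∀ ε > (0 : ℝ), ∀ᶠ j in atTop, ∀ (i : ι) (v : HexVertex),
        (∀ ℓ : Fin 3, |skewCoord ℓ ((s (ψ j) : ℂ) * hexCenter v - τ (ψ j) - C i)| ≤ ϱ i - ε) →
          v ∈ hexBall (g (ψ j) i).1 (g (ψ j) i).2) ∧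
      (∀ ε > (0 : ℝ), ∀ᶠ j in atTop, ∀ (i : ι), ∀ v ∈ hexBall (g (ψ j) i).1 (g (ψ j) i).2,
        ∀ ℓ : Fin 3, |skewCoord ℓ ((s (ψ j) : ℂ) * hexCenter v - τ (ψ j) - C i)| ≤ ϱ i + ε) ∧
      (∀ K : Set ℂ, IsCompact K → (∀ i, Disjoint K {z : ℂ | ∀ ℓ : Fin 3, |skewCoord ℓ (z - C i)| ≤ ϱ i}) →
        ∀ᶠ j in atTop, ∀ (i : ι), ∀ v ∈ hexBall (g (ψ j) i).1 (g (ψ j) i).2,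
          (s (ψ j) : ℂ) * hexCenter v - τ (ψ j) ∉ K) := by
  classical
  -- pinned centres and radii
  set Ck : ℕ → ι → ℂ := fun j i => (s j : ℂ) * hexCenter (g j i).1 - τ j with hCk
  set ϱk : ℕ → ι → ℝ := fun j i => s j * ((g j i).2 + 1 / 2) with hϱk
  -- bounds
  have hCbd : ∀ j i, dist (Ck j i) ((s j : ℂ) * hexCenter (root j i) - τ j) ≤ R := by
    intro j i
    rw [hCk]; simp only; rw [dist_sub_right]
    exact hloc j i _ (mem_hexBall_self _ _)
  have hϱbd : ∀ j i, 0 ≤ ϱk j i ∧ ϱk j i ≤ 2 * R + s j := by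
    intro j i
    refine ⟨mul_nonneg (hspos j).le (by positivity), ?_⟩
    obtain ⟨hmem, hctr⟩ := shift_mem_hexBall (g j i).1 (g j i).2
    have h1 := hloc j i _ hmem
    have h2 := hloc j i _ (mem_hexBall_self _ _)
    have h3 : dist ((s j : ℂ) * hexCenter (((g j i).1.1 + Pi.single 1 ((g j i).2 : ℤ), (g j i).1.2) : HexVertex))
        ((s j : ℂ) * hexCenter (g j i).1) = s j * (g j i).2 := by
      rw [hctr, dist_eq_norm, mul_add, add_sub_cancel_left, norm_mul, norm_mul, Complex.norm_real,
        Complex.norm_natCast, norm_triZeta, mul_one, Real.norm_of_nonneg (hspos j).le]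
    have h4 := dist_triangle ((s j : ℂ) * hexCenter (((g j i).1.1 + Pi.single 1 ((g j i).2 : ℤ), (g j i).1.2) : HexVertex))
      ((s j : ℂ) * hexCenter (root j i)) ((s j : ℂ) * hexCenter (g j i).1)
    rw [dist_comm ((s j : ℂ) * hexCenter (root j i))] at h4
    rw [hϱk]; simp only
    nlinarith [hspos j]
  -- the root sequence and the meshes are bounded eventually
  have hrootbd : ∀ᶠ j in atTop, ∀ i, dist ((s j : ℂ) * hexCenter (root j i) - τ j) (ℓ₀ i) < 1 := by
    rw [eventually_all]
    exact fun i => (tendsto_iff_dist_tendsto_zero.1 (hrootlim i)).eventually (gt_mem_nhds one_pos)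
  have hsbd : ∀ᶠ j in atTop, s j < 1 := (tendsto_order.1 hs0).2 1 one_pos
  -- Bolzano–Weierstrass in the product
  set P : ℕ → (ι → ℂ) × (ι → ℝ) := fun j => (Ck j, ϱk j) with hP
  set p₀ : (ι → ℂ) × (ι → ℝ) := (ℓ₀, fun _ => 0) with hp₀
  have hPbd : ∀ᶠ j in atTop, P j ∈ closedBall p₀ (2 * |R| + 2) := by
    filter_upwards [hrootbd, hsbd] with j hj hsj
    rw [mem_closedBall, Prod.dist_eq, max_le_iff]
    have hRabs : R ≤ |R| := le_abs_self R
    constructor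
    · refine (dist_pi_le_iff (by positivity)).2 fun i => ?_
      calc dist (Ck j i) (ℓ₀ i) ≤ dist (Ck j i) ((s j : ℂ) * hexCenter (root j i) - τ j) +
            dist ((s j : ℂ) * hexCenter (root j i) - τ j) (ℓ₀ i) := dist_triangle _ _ _
        _ ≤ 2 * |R| + 2 := by linarith [hCbd j i, abs_nonneg R, hj i]
    · refine (dist_pi_le_iff (by positivity)).2 fun i => ?_
      rw [Real.dist_eq, sub_zero, abs_of_nonneg (hϱbd j i).1]
      linarith [(hϱbd j i).2, abs_nonneg R]
  obtain ⟨p, -, ψ, hψ, hlim⟩ := tendsto_subseq_of_frequently_bounded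
    (isBounded_closedBall (x := p₀) (r := 2 * |R| + 2)) hPbd.frequently
  -- coordinate limits
  have hClim : ∀ i, Tendsto (fun j => Ck (ψ j) i) atTop (𝓝 (p.1 i)) := fun i =>
    ((continuous_apply i).comp continuous_fst).continuousAt.tendsto.comp hlim
  have hϱlim : ∀ i, Tendsto (fun j => ϱk (ψ j) i) atTop (𝓝 (p.2 i)) := fun i =>
    ((continuous_apply i).comp continuous_snd).continuousAt.tendsto.comp hlim
  have hsψ : Tendsto (fun j => s (ψ j)) atTop (𝓝 0) := hs0.comp hψ.tendsto_atTop
  have hϱnn : ∀ i, 0 ≤ p.2 i := fun i =>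
    ge_of_tendsto' (hϱlim i) fun j => (hϱbd (ψ j) i).1
  have hCR : ∀ i, dist (p.1 i) (ℓ₀ i) ≤ R := by
    intro i
    refine le_of_tendsto' ((continuous_dist.continuousAt.tendsto).comp ((hClim i).prodMk_nhds
      ((hrootlim i).comp hψ.tendsto_atTop))) fun j => ?_
    exact hCbd (ψ j) i
  -- the sandwich, per hexagon
  have hsand : ∀ ε > (0 : ℝ), ∀ᶠ j in atTop, ∀ i, dist (Ck (ψ j) i) (p.1 i) < ε / 6 ∧
      |ϱk (ψ j) i - p.2 i| < ε / 6 ∧ s (ψ j) < ε / 6 := by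
    intro ε hε
    have h1 : ∀ i, ∀ᶠ j in atTop, dist (Ck (ψ j) i) (p.1 i) < ε / 6 := fun i =>
      (tendsto_iff_dist_tendsto_zero.1 (hClim i)).eventually (gt_mem_nhds (by positivity))
    have h2 : ∀ i, ∀ᶠ j in atTop, |ϱk (ψ j) i - p.2 i| < ε / 6 := fun i => by
      have := (tendsto_iff_dist_tendsto_zero.1 (hϱlim i)).eventually (gt_mem_nhds (by positivity : (0:ℝ) < ε / 6))
      exact this.mono fun j hj => by rwa [Real.dist_eq] at hj
    have h3 : ∀ᶠ j in atTop, s (ψ j) < ε / 6 := (tendsto_order.1 hsψ).2 _ (by positivity)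
    have h12 : ∀ᶠ j in atTop, ∀ i, dist (Ck (ψ j) i) (p.1 i) < ε / 6 ∧ |ϱk (ψ j) i - p.2 i| < ε / 6 := by
      rw [eventually_all]; exact fun i => (h1 i).and (h2 i)
    filter_upwards [h12, h3] with j hj hsj i
    exact ⟨(hj i).1, (hj i).2, hsj⟩
  -- containment
  have hcont : ∀ ε > (0 : ℝ), ∀ᶠ j in atTop, ∀ (i : ι), ∀ v ∈ hexBall (g (ψ j) i).1 (g (ψ j) i).2,
      ∀ ℓ : Fin 3, |skewCoord ℓ ((s (ψ j) : ℂ) * hexCenter v - τ (ψ j) - p.1 i)| ≤ p.2 i + ε := by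
    intro ε hε
    filter_upwards [hsand ε hε] with j hj i v hv ℓ
    rw [mem_hexBall_iff_hexCenter_mem_contHex (hspos (ψ j))] at hv
    have e : (s (ψ j) : ℂ) * hexCenter v = ((s (ψ j) : ℂ) * hexCenter v - τ (ψ j)) + τ (ψ j) := by ring
    rw [e] at hv
    have h0 := abs_le_of_pinned_mem_contHex (hspos (ψ j)) _ _ _ _ hv ℓ
    obtain ⟨hd, hr, hsj⟩ := hj i
    have h1 := abs_skewCoord_sub_le_of_dist ℓ ((s (ψ j) : ℂ) * hexCenter v - τ (ψ j)) (Ck (ψ j) i) (p.1 i)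
    rw [abs_lt] at hr
    change |skewCoord ℓ ((s (ψ j) : ℂ) * hexCenter v - τ (ψ j) - Ck (ψ j) i)| ≤ ϱk (ψ j) i + s (ψ j) / 6 at h0
    linarith
  refine ⟨ψ, p.1, p.2, hψ, hϱnn, hCR, hClim, hϱlim, ?_, hcont, ?_⟩
  · -- persistence
    intro ε hε
    filter_upwards [hsand ε hε] with j hj i v hv
    rw [mem_hexBall_iff_hexCenter_mem_contHex (hspos (ψ j))]
    have e : (s (ψ j) : ℂ) * hexCenter v = ((s (ψ j) : ℂ) * hexCenter v - τ (ψ j)) + τ (ψ j) := by ring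
    rw [e]
    refine pinned_mem_contHex_of_abs_le (hspos (ψ j)) _ _ _ _ fun ℓ => ?_
    obtain ⟨hd, hr, hsj⟩ := hj i
    have h1 := abs_skewCoord_sub_le_of_dist ℓ ((s (ψ j) : ℂ) * hexCenter v - τ (ψ j)) (p.1 i) (Ck (ψ j) i)
    rw [dist_comm] at hd
    have h2 := hv ℓ
    rw [abs_lt] at hr
    show |skewCoord ℓ ((s (ψ j) : ℂ) * hexCenter v - τ (ψ j) - Ck (ψ j) i)| ≤ ϱk (ψ j) i - s (ψ j) / 6
    linarith
  · -- eventual carving of compacts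
    intro K hK hdisj
    -- a common positive thickening missing `K`
    have hthick : ∀ i, ∃ ε > (0 : ℝ), Disjoint K {z : ℂ | ∀ ℓ : Fin 3, |skewCoord ℓ (z - p.1 i)| ≤ p.2 i + ε} := by
      intro i
      have hd := hdisj i
      rw [skewHexAbs_eq] at hd
      obtain ⟨ε, hε, hε'⟩ := exists_pos_disjoint_skewHex_thicken hK hd
      refine ⟨ε, hε, ?_⟩
      rw [skewHexAbs_eq]
      refine Set.disjoint_left.2 fun z hzK hz => Set.disjoint_left.1 hε' hzK fun ℓ => ?_
      obtain ⟨h1, h2⟩ := hz ℓ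
      constructor <;> linarith
    choose εi hεi hdisji using hthick
    obtain ⟨ε, hε, hεle⟩ := exists_min_pos εi hεi
    filter_upwards [hcont ε hε] with j hj i v hi hvK
    exact Set.disjoint_left.1 (hdisji i) hvK fun ℓ => (hj i v hi ℓ).trans (by linarith [hεle i])

/-! ### Finitely many fat sets at once -/

/-- **LIMITS OF FINITELY MANY PINNED FAT-SET SEQUENCES AT ONCE**; see the module docstring and
`fat_limits`. -/
theorem fats_limits {ι : Type*} [Finite ι] {s : ℕ → ℝ} {τ : ℕ → ℂ} {L : ι → ℕ → Set HexVertex}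
    {root : ι → ℕ → HexVertex} {R : ℝ} {r₀ : ι → ℝ} {ℓ₀ : ι → ℂ} {P : ι → ℕ → Set ℂ → Prop}
    (hr₀ : ∀ i, 0 < r₀ i) (hspos : ∀ j, 0 < s j) (hs0 : Tendsto s atTop (𝓝 0))
    (hloc : ∀ i j, ∀ v ∈ L i j, dist ((s j : ℂ) * hexCenter v) ((s j : ℂ) * hexCenter (root i j)) ≤ R)
    (hfat : ∀ i j, ∃ K : Set ℂ, IsCompact K ∧ IsConnected K ∧ (s j : ℂ) * hexCenter (root i j) ∈ K ∧
      (∀ v : HexVertex, infDist ((s j : ℂ) * hexCenter v) K ≤ r₀ i → v ∈ L i j) ∧ P i j K)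
    (hrootlim : ∀ i, Tendsto (fun j => (s j : ℂ) * hexCenter (root i j) - τ j) atTop (𝓝 (ℓ₀ i))) :
    ∃ (ψ : ℕ → ℕ) (Kinf : ι → Set ℂ) (Ko Kp : ι → ℕ → Set ℂ), StrictMono ψ ∧ ∀ i,
      IsCompact (Kinf i) ∧ IsConnected (Kinf i) ∧ ℓ₀ i ∈ Kinf i ∧ Kinf i ⊆ closedBall (ℓ₀ i) (R + 1) ∧
      (∀ j, Kp i j = (fun w : ℂ => w - τ (ψ j)) '' Ko i j ∧ IsCompact (Ko i j) ∧ IsConnected (Ko i j) ∧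
        (s (ψ j) : ℂ) * hexCenter (root i (ψ j)) ∈ Ko i j ∧
        (∀ v : HexVertex, infDist ((s (ψ j) : ℂ) * hexCenter v) (Ko i j) ≤ r₀ i → v ∈ L i (ψ j)) ∧
        P i (ψ j) (Ko i j)) ∧
      (∀ j, IsCompact (Kp i j) ∧ IsConnected (Kp i j) ∧
        (s (ψ j) : ℂ) * hexCenter (root i (ψ j)) - τ (ψ j) ∈ Kp i j ∧ Kp i j ⊆ closedBall (ℓ₀ i) (R + 1) ∧
        (∀ v : HexVertex, infDist ((s (ψ j) : ℂ) * hexCenter v - τ (ψ j)) (Kp i j) ≤ r₀ i → v ∈ L i (ψ j))) ∧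
      Tendsto (fun j => hausdorffDist (Kp i j) (Kinf i)) atTop (𝓝 0) ∧
      (∀ ε > (0 : ℝ), ∀ᶠ j in atTop, ∀ v : HexVertex,
        infDist ((s (ψ j) : ℂ) * hexCenter v - τ (ψ j)) (Kinf i) ≤ r₀ i - ε → v ∈ L i (ψ j)) := by
  classical
  choose K hKc hKconn hKroot hKfat hKP using hfat
  -- the pinned fat sets
  set Kq : ι → ℕ → Set ℂ := fun i j => (fun w : ℂ => w - τ j) '' K i j with hKq
  have hKqc : ∀ i j, IsCompact (Kq i j) := fun i j => (hKc i j).image (continuous_id.sub continuous_const)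
  have hKqconn : ∀ i j, IsConnected (Kq i j) := fun i j =>
    (hKconn i j).image _ (continuous_id.sub continuous_const).continuousOn
  have hKqroot : ∀ i j, (s j : ℂ) * hexCenter (root i j) - τ j ∈ Kq i j := fun i j => ⟨_, hKroot i j, rfl⟩
  have hKqfat : ∀ i j (v : HexVertex), infDist ((s j : ℂ) * hexCenter v - τ j) (Kq i j) ≤ r₀ i → v ∈ L i j := by
    intro i j v hv
    rw [hKq] at hv; simp only at hv; rw [infDist_sub_image] at hv
    exact hKfat i j v hv
  -- the pinned fat sets lie in fixed discs, eventually
  obtain ⟨rm, hrm, hrmle⟩ : ∃ rm > (0 : ℝ), ∀ i, rm ≤ r₀ i := exists_min_pos r₀ hr₀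
  have hsmall : ∀ᶠ j in atTop, s j < min rm (1 / 2) := (tendsto_order.1 hs0).2 _ (lt_min hrm (by norm_num))
  have hrootnear : ∀ᶠ j in atTop, ∀ i, dist ((s j : ℂ) * hexCenter (root i j) - τ j) (ℓ₀ i) < 1 / 2 := by
    rw [eventually_all]
    exact fun i => (tendsto_iff_dist_tendsto_zero.1 (hrootlim i)).eventually (gt_mem_nhds (by norm_num))
  have hdisc : ∀ᶠ j in atTop, ∀ i, Kq i j ⊆ closedBall (ℓ₀ i) (R + 1) := by
    filter_upwards [hsmall, hrootnear] with j hsj hrj i z hz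
    obtain ⟨z₀, hz₀, rfl⟩ := hz
    obtain ⟨v, hv⟩ := exists_vertex_dist_le (hspos j) z₀
    have hvL : v ∈ L i j := by
      refine hKfat i j v ((infDist_le_dist_of_mem hz₀).trans (hv.trans ?_))
      linarith [hsj.trans_le (min_le_left _ _), hrmle i]
    have h1 := hloc i j v hvL
    rw [mem_closedBall]
    calc dist (z₀ - τ j) (ℓ₀ i) ≤ dist (z₀ - τ j) ((s j : ℂ) * hexCenter (root i j) - τ j) +
          dist ((s j : ℂ) * hexCenter (root i j) - τ j) (ℓ₀ i) := dist_triangle _ _ _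
      _ = dist z₀ ((s j : ℂ) * hexCenter (root i j)) + dist ((s j : ℂ) * hexCenter (root i j) - τ j) (ℓ₀ i) := by
          rw [dist_sub_right]
      _ ≤ (dist z₀ ((s j : ℂ) * hexCenter v) + dist ((s j : ℂ) * hexCenter v) ((s j : ℂ) * hexCenter (root i j))) +
          dist ((s j : ℂ) * hexCenter (root i j) - τ j) (ℓ₀ i) := add_le_add (dist_triangle _ _ _) le_rfl
      _ ≤ (s j + R) + 1 / 2 := by
          refine add_le_add (add_le_add ?_ h1) (hrj i).le
          rw [dist_comm]; exact hv
      _ ≤ R + 1 := by linarith [hsj.trans_le (min_le_right _ _)]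
  obtain ⟨j₀, hj₀⟩ := eventually_atTop.1 hdisc
  -- one compact set containing all the discs
  obtain ⟨B, hB⟩ : ∃ B : ℝ, ∀ i, ‖ℓ₀ i‖ ≤ B := by
    haveI := Fintype.ofFinite ι
    rcases isEmpty_or_nonempty ι with hι | hι
    · exact ⟨0, fun i => (IsEmpty.false i).elim⟩
    · exact ⟨Finset.univ.sup' Finset.univ_nonempty fun i => ‖ℓ₀ i‖, fun i =>
        Finset.le_sup' (fun i => ‖ℓ₀ i‖) (Finset.mem_univ i)⟩
  have hsubbig : ∀ i, closedBall (ℓ₀ i) (R + 1) ⊆ closedBall (0 : ℂ) (B + |R| + 1) := by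
    intro i z hz
    rw [mem_closedBall, dist_zero_right] at *
    calc ‖z‖ = ‖(z - ℓ₀ i) + ℓ₀ i‖ := by rw [sub_add_cancel]
      _ ≤ ‖z - ℓ₀ i‖ + ‖ℓ₀ i‖ := norm_add_le _ _
      _ ≤ (R + 1) + B := add_le_add (by rwa [← dist_eq_norm]) (hB i)
      _ ≤ B + |R| + 1 := by linarith [le_abs_self R]
  -- Blaschke selection for the shifted sequences
  set F : ℕ → ι → NonemptyCompacts ℂ := fun j i =>
    ⟨⟨Kq i (j₀ + j), hKqc i (j₀ + j)⟩, ⟨_, hKqroot i (j₀ + j)⟩⟩ with hF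
  have hFK : ∀ j i, ((F j i : Set ℂ)) ⊆ closedBall (0 : ℂ) (B + |R| + 1) := fun j i =>
    (hj₀ (j₀ + j) (by omega) i).trans (hsubbig i)
  obtain ⟨ψ₁, Lim, hψ₁, -, hconv⟩ :=
    exists_subseq_tendsto_nonemptyCompacts_pi (isCompact_closedBall (0 : ℂ) (B + |R| + 1)) F hFK
  have hH : ∀ i, Tendsto (fun j => hausdorffDist (Kq i (j₀ + ψ₁ j)) ((Lim i : Set ℂ))) atTop (𝓝 0) := fun i => by
    have := tendsto_hausdorffDist_of_tendsto hconv i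
    exact this
  have hfin : ∀ i j, hausdorffEDist (Kq i (j₀ + ψ₁ j)) ((Lim i : Set ℂ)) ≠ ⊤ := fun i j =>
    hausdorffEDist_ne_top_nonemptyCompacts (F (ψ₁ j) i) (Lim i)
  -- the subsequence
  set ψ : ℕ → ℕ := fun j => j₀ + ψ₁ j with hψdef
  have hψ : StrictMono ψ := fun a b hab => by simp only [hψdef]; exact Nat.add_lt_add_left (hψ₁ hab) _
  -- the limits
  have hLimc : ∀ i, IsCompact ((Lim i : Set ℂ)) := fun i => (Lim i).isCompact
  have hℓ₀ : ∀ i, ℓ₀ i ∈ (Lim i : Set ℂ) := fun i =>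
    mem_of_tendsto_of_hausdorffDist_tendsto (hLimc i).isClosed (Lim i).nonempty (hfin i) (hH i)
      (fun j => hKqroot i (j₀ + ψ₁ j)) ((hrootlim i).comp hψ.tendsto_atTop)
  have hLimconn : ∀ i, IsConnected ((Lim i : Set ℂ)) := fun i =>
    ⟨⟨ℓ₀ i, hℓ₀ i⟩, isPreconnected_of_hausdorffDist_tendsto (hLimc i)
      (fun j => (hKqconn i (j₀ + ψ₁ j)).isPreconnected) (hfin i) (hH i)⟩
  have hLimdisc : ∀ i, ((Lim i : Set ℂ)) ⊆ closedBall (ℓ₀ i) (R + 1) := by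
    intro i w hw
    -- points of the limit are within `R + 1` of the limit root, by Hausdorff convergence
    by_contra hfar
    rw [mem_closedBall, not_le] at hfar
    -- `w` is at positive distance from every `Kq i (j₀ + ψ₁ j)`, contradicting Hausdorff convergence
    have hgap : 0 < dist w (ℓ₀ i) - (R + 1) := by linarith
    have hev := (tendsto_order.1 (hH i)).2 _ hgap
    obtain ⟨j, hj⟩ := hev.exists
    have h1 : infDist w (Kq i (j₀ + ψ₁ j)) ≤ hausdorffDist (Kq i (j₀ + ψ₁ j)) ((Lim i : Set ℂ)) := by
      have := infDist_le_infDist_add_hausdorffDist (x := w) (s := ((Lim i : Set ℂ))) (t := Kq i (j₀ + ψ₁ j))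
        (by rw [hausdorffEDist_comm]; exact hfin i j)
      rw [infDist_zero_of_mem hw, zero_add, hausdorffDist_comm] at this
      exact this
    have h2 : dist w (ℓ₀ i) - (R + 1) ≤ infDist w (Kq i (j₀ + ψ₁ j)) := by
      rw [le_infDist ⟨_, hKqroot i (j₀ + ψ₁ j)⟩]
      intro y hy
      have hy' := hj₀ (j₀ + ψ₁ j) (by omega) i hy
      rw [mem_closedBall] at hy'
      linarith [dist_triangle w y (ℓ₀ i)]
    linarith
  refine ⟨ψ, fun i => (Lim i : Set ℂ), fun i j => K i (ψ j), fun i j => Kq i (ψ j), hψ, fun i =>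
    ⟨hLimc i, hLimconn i, hℓ₀ i, hLimdisc i, fun j => ⟨rfl, hKc _ _, hKconn _ _, hKroot _ _, hKfat _ _, hKP _ _⟩,
    fun j => ⟨hKqc _ _, hKqconn _ _, hKqroot _ _, hj₀ _ (by simp only [hψdef]; omega) i, hKqfat _ _⟩, hH i,
    fun ε hε => ?_⟩⟩
  -- persistence of the core
  have hev : ∀ᶠ j in atTop, hausdorffDist (Kq i (j₀ + ψ₁ j)) ((Lim i : Set ℂ)) < ε := (tendsto_order.1 (hH i)).2 ε hε
  filter_upwards [hev] with j hj v hv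
  refine hKqfat i (ψ j) v ?_
  have h1 := infDist_le_infDist_add_hausdorffDist (x := (s (ψ j) : ℂ) * hexCenter v - τ (ψ j))
    (s := ((Lim i : Set ℂ))) (t := Kq i (j₀ + ψ₁ j)) (by rw [hausdorffEDist_comm]; exact hfin i j)
  rw [hausdorffDist_comm] at h1
  change infDist ((s (ψ j) : ℂ) * hexCenter v - τ (ψ j)) (Kq i (j₀ + ψ₁ j)) ≤ r₀ i
  linarith

end Summit.CriticalPhenomena.SAWScalingLimit.Theorems.ObservableToSLE.TypeLadder

end
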